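import Mathlib.FieldTheory.SeparablyGenerated
import Mathlib.RingTheory.Etale.Field
import Mathlib.RingTheory.Flat.Basic
import Mathlib.RingTheory.Localization.BaseChange
import Mathlib.RingTheory.TensorProduct.MvPolynomial
import Mathlib.RingTheory.AlgebraicIndependent.Adjoin
import Mathlib.FieldTheory.IntermediateField.Adjoin.Algebra
import Mathlib.AlgebraicGeometry.Geometrically.Reduced
import Literature.AlgebraicGeometry.Motives.VarietiesGeometricallyIntegralProofs
import HarnessLib

/-!
# Field extensions of a perfect field are geometrically reduced (EGA IV₂ 4.3.6, 4.6.1)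

Grothendieck–Dieudonné, EGA IV₂ (Publ. Math. IHÉS 24, 1965), Cor. (4.3.6), p. 58: *"Si `k` est
parfait, alors, pour deux extensions quelconques `K`, `L` de `k`, `K ⊗_k L` est réduit, et
réciproquement"*, a corollary of Prop. (4.3.5), p. 58: *"Soient `K`, `L` deux extensions d'un corps
`k`. Si `L` est une extension séparable de `k`, l'anneau `L ⊗_k K` est réduit"* (proof referred to
Bourbaki, *Alg.* VIII §7 no. 3, th. 1). In scheme-theoretic language this is Prop. (4.6.1), p. 68
(*"Soient `k` un corps, `X` un `k`-préschéma, `Ω` une extension parfaite de `k`. Les conditions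
suivantes sont équivalentes : a) Pour tout `k`-préschéma réduit `S`, `X ×_k S` est réduit. b) Pour
toute extension `K` de `k`, `X ⊗_k K` est réduit. c) `X ⊗_k Ω` est réduit. […]"*) with `Ω = k`
perfect and `X = Spec L`: the morphism `Spec L → Spec k` is geometrically reduced ("séparable",
Déf. (4.6.2)) in Mathlib's sense (`AlgebraicGeometry.GeometricallyReduced`). This file proves these
statements; they are the input "over a perfect field all multiplicities of
`closure {z} ×_k Spec L` are `1`" of the base change of cycle classes
(`Literature/AlgebraicGeometry/Motives/CyclesEquivalences`,
`Literature.AlgebraicGeometry.Motives.comap_cycleClass_eq_cycleMap_baseChange`, discharged in `CyclesEquivalencesProofs`).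

## Proof

Mathlib has geometric reducedness of algebras and schemes (`Algebra.IsGeometricallyReduced`,
`AlgebraicGeometry.GeometricallyReduced`) and, for perfect ground fields, the existence of
separating transcendence bases of finitely generated extensions
(`exists_isTranscendenceBasis_and_isSeparable_of_perfectField`, Stacks 030W/0H71), but not the
conclusion "`K ⊗_k L` reduced" (a TODO in `Mathlib/RingTheory/Nilpotent/GeometricallyReduced`).
We follow the classical route through separating transcendence bases (Stacks 030W; EGA IV₂
(4.3.5) via Bourbaki):

* `Literature.AlgebraicGeometry.Motives.isDomain_tensorProduct_fractionRing_mvPolynomial`: `L ⊗_k k(xᵢ)` is a domain, being the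
  localisation of the polynomial ring `L[xᵢ] = k[xᵢ] ⊗_k L` at the non-zero elements of `k[xᵢ]`
  (Mathlib `IsLocalization.tensor`, `MvPolynomial.algebraTensorAlgEquiv`); hence
  `L ⊗_k k(s)` is a domain for an algebraically independent family `s`
  (`Literature.AlgebraicGeometry.Motives.isDomain_tensorProduct_adjoin_of_algebraicIndependent`, Mathlib
  `AlgebraicIndependent.aevalEquivField`).
* `Literature.AlgebraicGeometry.Motives.isReduced_tensorProduct_of_isSeparable_of_isDomain`: if `k ⊆ F ⊆ E` with `E/F` separable
  algebraic, `E/k` essentially of finite type and `L ⊗_k F` a domain, then `L ⊗_k E ≅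
  (F ⊗_k L) ⊗_F E` is étale over the domain `F ⊗_k L` (Mathlib
`Algebra.FormallyEtale.of_isSeparable`,
  `Algebra.Etale.baseChange`), hence reduced (`Literature.AlgebraicGeometry.Motives.isReduced_of_etale_of_isDomain`).
* `Literature.AlgebraicGeometry.Motives.isReduced_tensorProduct_of_essFiniteType_of_perfectField`: for `E/k` finitely generated
  over a perfect field, choose a separating transcendence basis (Mathlib) and combine.
* `Literature.AlgebraicGeometry.Motives.isReduced_tensorProduct_of_perfectField` (EGA IV₂ Cor. (4.3.6)): the general case
  `L ⊗_k K` reduces to finitely generated subalgebras `B ⊆ K` (Mathlib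
  `IsReduced.tensorProduct_of_flat_of_forall_fg`), and `L ⊗_k B ⊆ L ⊗_k Frac(B)` by flatness.
* `Literature.AlgebraicGeometry.Motives.geometricallyReduced_SpecMap_of_perfectField` (EGA IV₂ (4.6.1)): `Spec L → Spec k` is
  geometrically reduced (Mathlib `geometrically_iff_of_commRing_of_isClosedUnderIsomorphisms`,
  `pullbackSpecIso`).

Design: to avoid the slow instance paths of subtypes of `IntermediateField` as base rings of
tensor products, the tower step is stated for an abstract intermediate field `F` (a type with
`IsScalarTower k F E`) and only instantiated at `IntermediateField.adjoin k s` at the end.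

## References

* A. Grothendieck, J. Dieudonné, *Éléments de géométrie algébrique IV₂*, Publ. Math. IHÉS 24
  (1965): Prop. (4.3.2), Prop. (4.3.5), Cor. (4.3.6), p. 58; Prop. (4.6.1) and Déf. (4.6.2),
  p. 68.
* The Stacks Project, Tags 030W (separably generated extensions), 0H71, 05DS.
* U. Görtz, T. Wedhorn, *Algebraic Geometry II* (2023), Prop. 18.24 / Rem. 18.25 (unramified
  algebras over a field are reduced) — via `Literature.AlgebraicGeometry.Motives.isReduced_of_etale_of_isDomain`.
-/

universe u

open TensorProduct

namespace Literature.AlgebraicGeometry.Motives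

/-! ### Purely transcendental extensions: `L ⊗ₖ k(xᵢ)` is a domain -/

section PurelyTranscendental

variable (k L : Type*) [Field k] [Field L] [Algebra k L] (ι : Type*)

/-- For a field extension `L/k` and a set of indeterminates `ι`, the ring
`L ⊗_k Frac(k[xᵢ]) = L ⊗_k k(xᵢ)` is an integral domain: it is the localisation of the polynomial
ring `k[xᵢ] ⊗_k L ≅ L[xᵢ]` at the (non-zero, hence regular) image of `k[xᵢ] ∖ {0}`
(a purely transcendental extension is primary and separable, so this is a case of EGA IV₂
Prop. (4.3.2) with Prop. (4.3.5), p. 58). Proved from Mathlib's `IsLocalization.tensor` and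
`MvPolynomial.algebraTensorAlgEquiv`. [folklore] -/
theorem isDomain_tensorProduct_fractionRing_mvPolynomial :
    IsDomain (L ⊗[k] FractionRing (MvPolynomial ι k)) := by
  set P := MvPolynomial ι k with hP
  set Q := FractionRing (MvPolynomial ι k) with hQ
  -- `P ⊗ₖ L ≃ L[xᵢ]` is a domain
  haveI : IsDomain (P ⊗[k] L) :=
    MulEquiv.isDomain (MvPolynomial ι L)
      ((Algebra.TensorProduct.comm k P L).trans
        ((MvPolynomial.algebraTensorAlgEquiv k L).restrictScalars k)).toMulEquiv
  -- `(P ⊗ₖ L) ⊗_P Q` is the localisation of `P ⊗ₖ L` at the image of `P ∖ {0}`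
  haveI : IsLocalization (Algebra.algebraMapSubmonoid (P ⊗[k] L) (nonZeroDivisors P))
      ((P ⊗[k] L) ⊗[P] Q) := IsLocalization.tensor Q (nonZeroDivisors P)
  haveI : IsDomain ((P ⊗[k] L) ⊗[P] Q) := by
    refine IsLocalization.isDomain_of_le_nonZeroDivisors
      (M := Algebra.algebraMapSubmonoid (P ⊗[k] L) (nonZeroDivisors P)) ((P ⊗[k] L) ⊗[P] Q) ?_
    rintro _ ⟨p, hp, rfl⟩
    refine mem_nonZeroDivisors_of_ne_zero ?_
    have hinj : Function.Injective
        (Algebra.TensorProduct.includeLeft (R := k) (S := k) (A := P) (B := L)) :=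
      Algebra.TensorProduct.includeLeft_injective (algebraMap k L).injective
    intro h
    apply nonZeroDivisors.ne_zero hp
    apply hinj
    rw [map_zero]
    exact h
  -- transport along `L ⊗ₖ Q ≃ Q ⊗ₖ L ≃ Q ⊗_P (P ⊗ₖ L) ≃ (P ⊗ₖ L) ⊗_P Q`
  let e : L ⊗[k] Q ≃+* (P ⊗[k] L) ⊗[P] Q :=
    (Algebra.TensorProduct.comm k L Q).toRingEquiv.trans
      ((Algebra.TensorProduct.cancelBaseChange k P Q Q L).symm.toRingEquiv.trans
        (Algebra.TensorProduct.comm P Q (P ⊗[k] L)).toRingEquiv)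
  exact MulEquiv.isDomain ((P ⊗[k] L) ⊗[P] Q) e.toMulEquiv

variable {k L ι} in
/-- For an algebraically independent family `x` in a field extension `E/k` and any field
extension `L/k`, the ring `L ⊗_k k(x)` is an integral domain (`k(x) ≅ Frac(k[xᵢ])` by Mathlib's
`AlgebraicIndependent.aevalEquivField`; EGA IV₂ Prop. (4.3.2) with Prop. (4.3.5), p. 58).
[folklore] -/
theorem isDomain_tensorProduct_adjoin_of_algebraicIndependent {E : Type*} [Field E] [Algebra k E]
    {x : ι → E} (hx : AlgebraicIndependent k x) :
    IsDomain (L ⊗[k] IntermediateField.adjoin k (Set.range x)) :=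
  haveI := isDomain_tensorProduct_fractionRing_mvPolynomial k L ι
  MulEquiv.isDomain (L ⊗[k] FractionRing (MvPolynomial ι k))
    (Algebra.TensorProduct.congr (AlgEquiv.refl : L ≃ₐ[k] L) hx.aevalEquivField).symm.toMulEquiv

end PurelyTranscendental

/-! ### Separably generated extensions are geometrically reduced -/

section Separable

variable (k L F E : Type*) [Field k] [Field L] [Algebra k L] [Field F] [Algebra k F] [Field E]
  [Algebra k E] [Algebra F E] [IsScalarTower k F E]

/-- The tower step of EGA IV₂ Prop. (4.3.5) (*"Si `L` est une extension séparable de `k`, l'anneau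
`L ⊗_k K` est réduit"*) for separably generated extensions (Stacks 030W): for a tower of fields
`k ⊆ F ⊆ E` with `E/F` separable algebraic and `E/k` essentially of finite type, and a field
extension `L/k` such that `L ⊗_k F` is a domain, the ring `L ⊗_k E` is reduced. Indeed `E/F` is
finite étale, so `L ⊗_k E ≅ (F ⊗_k L) ⊗_F E` is étale over the domain `F ⊗_k L` and therefore
reduced (`Literature.AlgebraicGeometry.Motives.isReduced_of_etale_of_isDomain`).
[cite: GrothendieckDieudonne1965, Prop. (4.3.5), p. 58] -/
theorem isReduced_tensorProduct_of_isSeparable_of_isDomain [Algebra.IsSeparable F E]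
    [Algebra.EssFiniteType k E] [IsDomain (L ⊗[k] F)] : IsReduced (L ⊗[k] E) := by
  haveI : IsDomain (F ⊗[k] L) :=
    MulEquiv.isDomain (L ⊗[k] F) (Algebra.TensorProduct.comm k F L).toMulEquiv
  -- `E / F` is finite separable, i.e. étale
  haveI : Algebra.FormallyEtale F E := Algebra.FormallyEtale.of_isSeparable F E
  haveI : Algebra.EssFiniteType F E := Algebra.EssFiniteType.of_comp k F E
  haveI : Module.Finite F E := Algebra.FormallyUnramified.finite_of_free F E
  haveI : Algebra.FinitePresentation F E :=
    (Algebra.FinitePresentation.of_finiteType (R := F) (A := E)).mp inferInstance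
  haveI : Algebra.Etale F E := {}
  -- hence `(F ⊗ₖ L) ⊗_F E` is étale over the domain `F ⊗ₖ L`, so reduced
  haveI : IsReduced ((F ⊗[k] L) ⊗[F] E) := isReduced_of_etale_of_isDomain (F ⊗[k] L) _
  -- transport along `L ⊗ₖ E ≃ E ⊗ₖ L ≃ E ⊗_F (F ⊗ₖ L) ≃ (F ⊗ₖ L) ⊗_F E`
  let e : L ⊗[k] E ≃+* (F ⊗[k] L) ⊗[F] E :=
    (Algebra.TensorProduct.comm k L E).toRingEquiv.trans
      ((Algebra.TensorProduct.cancelBaseChange k F E E L).symm.toRingEquiv.trans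
        (Algebra.TensorProduct.comm F E (F ⊗[k] L)).toRingEquiv)
  exact isReduced_of_injective e e.injective

end Separable

/-! ### Field extensions of a perfect field are geometrically reduced -/

section Perfect

variable (k L : Type*) [Field k] [PerfectField k] [Field L] [Algebra k L]

/-- **EGA IV₂ Cor. (4.3.6), finitely generated case.** For a perfect field `k`, a finitely
generated field extension `E/k` and an arbitrary field extension `L/k`, the ring `L ⊗_k E` is
reduced. Proof: `E` has a separating transcendence basis `s` over the perfect field `k` (Mathlib
`exists_isTranscendenceBasis_and_isSeparable_of_perfectField`, Stacks 030W), `L ⊗_k k(s)` is a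
domain, and the tower step `isReduced_tensorProduct_of_isSeparable_of_isDomain` applies.
[cite: GrothendieckDieudonne1965, Cor. (4.3.6), p. 58] -/
theorem isReduced_tensorProduct_of_essFiniteType_of_perfectField (E : Type*) [Field E] [Algebra k E]
    [Algebra.EssFiniteType k E] : IsReduced (L ⊗[k] E) := by
  obtain ⟨s, hs, hsep⟩ := exists_isTranscendenceBasis_and_isSeparable_of_perfectField k E
  -- `L ⊗ₖ k(s)` is a domain (`k(s)` purely transcendental)
  haveI : IsDomain (L ⊗[k] IntermediateField.adjoin k (↑s : Set E)) := by
    have h := isDomain_tensorProduct_adjoin_of_algebraicIndependent (L := L) hs.1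
    rwa [Subtype.range_coe_subtype, Finset.setOf_mem] at h
  exact isReduced_tensorProduct_of_isSeparable_of_isDomain k L
    (IntermediateField.adjoin k (↑s : Set E)) E

/-- **EGA IV₂ Cor. (4.3.6)** (*"Si `k` est parfait, alors, pour deux extensions quelconques `K`, `L`
de `k`, `K ⊗_k L` est réduit"*; only this direction is formalised, not "et réciproquement").
For field extensions `L`, `K` of a perfect field `k`, the ring `L ⊗_k K` is reduced; equivalently
(Prop. (4.6.1) c) ⇒ b) with `Ω = k`, Déf. (4.6.2)) every field extension of a perfect field is
separable. The general case is reduced to finitely generated subalgebras `B ⊆ K` (Mathlib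
`IsReduced.tensorProduct_of_flat_of_forall_fg`), using `L ⊗_k B ⊆ L ⊗_k Frac(B)` (flatness of
`L` over `k`) and `isReduced_tensorProduct_of_essFiniteType_of_perfectField`.
[cite: GrothendieckDieudonne1965, Cor. (4.3.6), p. 58] -/
theorem isReduced_tensorProduct_of_perfectField (K : Type*) [Field K] [Algebra k K] :
    IsReduced (L ⊗[k] K) := by
  refine IsReduced.tensorProduct_of_flat_of_forall_fg fun B hB ↦ ?_
  haveI : Algebra.FiniteType k B := ⟨(Subalgebra.fg_top B).mpr hB⟩
  let E := FractionRing B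
  haveI : Algebra.EssFiniteType B E := Algebra.EssFiniteType.of_isLocalization E (nonZeroDivisors B)
  haveI : Algebra.EssFiniteType k E := Algebra.EssFiniteType.comp k B E
  haveI := isReduced_tensorProduct_of_essFiniteType_of_perfectField k L E
  exact isReduced_of_injective
    (Algebra.TensorProduct.map (1 : L →ₐ[k] L) (IsScalarTower.toAlgHom k B E))
    (Module.Flat.lTensor_preserves_injective_linearMap
      ((IsScalarTower.toAlgHom k B E : B →ₐ[k] E) : B →ₗ[k] E) (IsFractionRing.injective B E))

end Perfect

/-! ### Scheme-theoretic form -/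

section Schemes

open CategoryTheory _root_.AlgebraicGeometry

/-- **EGA IV₂ (4.6.1)–(4.6.2): `Spec L → Spec k` is geometrically reduced for `k` perfect.** For a
field extension `L` of a perfect field `k`, the morphism `Spec L ⟶ Spec k` is geometrically
reduced (Mathlib `AlgebraicGeometry.GeometricallyReduced`: all base changes `Spec L ×_k Spec K`
to fields `K/k` are reduced), since `Spec L ×_k Spec K ≅ Spec (L ⊗_k K)` (Mathlib
`pullbackSpecIso`) and `L ⊗_k K` is reduced (`isReduced_tensorProduct_of_perfectField`). By
Mathlib's base-change instances, every base change `X ×_k Spec L ⟶ X` is then geometrically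
reduced, and all its fibres are reduced schemes.
[cite: GrothendieckDieudonne1965, Prop. (4.6.1) and Déf. (4.6.2), p. 68] -/
theorem geometricallyReduced_SpecMap_of_perfectField (k L : Type u) [Field k] [PerfectField k]
    [Field L] [Algebra k L] :
    GeometricallyReduced (Spec.map (CommRingCat.ofHom (algebraMap k L))) := by
  rw [geometricallyReduced_iff, geometrically_iff_of_commRing_of_isClosedUnderIsomorphisms]
  intro K _ _
  haveI : _root_.IsReduced (L ⊗[k] K) := isReduced_tensorProduct_of_perfectField k L K
  exact isReduced_of_isOpenImmersion (pullbackSpecIso k L K).hom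

/-- `Spec σ : Spec L ⟶ Spec k` is geometrically reduced for a homomorphism `σ : k →+* L` of fields
with `k` perfect (the case `algebraMap k L = σ` of
`geometricallyReduced_SpecMap_of_perfectField`; EGA IV₂ (4.6.1)).
[cite: GrothendieckDieudonne1965, Prop. (4.6.1), p. 68] -/
theorem geometricallyReduced_SpecMap_ringHom_of_perfectField {k L : Type u} [Field k]
    [PerfectField k] [Field L] (σ : k →+* L) :
    GeometricallyReduced (Spec.map (CommRingCat.ofHom σ)) :=
  letI := σ.toAlgebra
  geometricallyReduced_SpecMap_of_perfectField k L

end Schemes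

end Literature.AlgebraicGeometry.Motives
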